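import Literature.MathematicalPhysics.QuantumFieldTheory.OSLabelledStep
import Literature.MathematicalPhysics.QuantumFieldTheory.OSSectorGrowth
import HarnessLib

/-!
# The first level of OS II's continuation from real-point data: (A₀), (P₀) ⇒ (A₁), with growth

Topic `Literature/MathematicalPhysics/QuantumFieldTheory`; support file (all proved; one
`Prop`-valued hypothesis bundle, the slot data and explicit constants as definitions; no named facts)
for the discharge of (A1) `OS1975_exists_timeContinuation`. Osterwalder–Schrader II (Comm. Math. Phys.
42 (1975)), Ch. V, (5.2)–(5.4), (5.7)–(5.8), (5.15)–(5.19), and Ch. VI.2 (6.20)–(6.23), (6.28): the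
**start of the induction** of Ch. V.2 — the level data (A₁) on `C_k^{(1)} = {∑ |arg ζᵢ| < π/2}`
((5.8), (5.18)–(5.19), (5.25)) with the growth (6.28) at `N = 1`, **from the real-point data only**:
the labelled Gram identities (5.2)/(5.17) at positive real points (OS's (P₀), pointwise), continuity
of the Schwinger functions on the positive orthant (Thm. 4.1) and their real-point bound (4.5)/(6.20)
in the form `‖S k c ρ‖ ≤ C₀ k Π(ρ)^{p₀ k}`, uniformly over a class of labels closed under the doubling
of the parts. This is the input `IsOSLabelledLevel 0` / `IsOSLabelledGrowth 0` of the labelled driver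
(`OSLabelledStep`), whence OS II Thm. 4.2 from real-point data (`IsOSLabelledRealData.exists_continuation`).

* `IsOSLabelledRealData good S₀ Φ C₀ p₀` — the real-point hypotheses;
* `IsOSLabelledRealData.gram_diag`, `norm_sq_vec`, `continuousOn_vec` — Gram kernel, norms and
  **continuity of the real-point vectors** `ξ ↦ Φ n a x ξ` (from continuity of `S₀` at the doubled
  label, `continuousOn_of_gram`);
* `Lr`, `Rr`, `slotE` — the **one-gap continuations (5.4)**
  `E_i(u', τ) = ⟪Φ i (c_i,…,c_0) (Re τ/4) left, e^{-(τ - Re τ/2)H} Φ (m-i) (c_{i+1},…) (Re τ/4) right⟫`,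
  with `slotE_ofReal` ((5.2) at `τ = x`), `differentiableOn_slotE` (`exists_generatingFunction`),
  `continuousOn_slotE`, `norm_slotE_le` (the Schwarz bound (6.22)–(6.23) on closed sectors, explicit
  constants `zslotConst`, `zCsec`);
* `IsOSLabelledRealData.isSectorData` — the real-point data of a good label are sector data of opening
  `π/2` (`OSSectorContinuation`), hence (`exists_levelZero`) **level data at `0` with growth**:
  `IsOSLabelledLevel 0 good S Φ`, `IsOSLabelledGrowth 0 good S (zeroConst …) (zeroExp …)`, `S = S₀` at
  the positive real points (continuation by `IsSectorData.exists_extension`, growth by the weighted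
  maximum principle `IsSectorData.norm_extension_le_gFactor`);
* `IsOSLabelledRealData.exists_continuation` — **OS II Thm. 4.2 from real-point data**: for every good
  label, `S₀ k c` continues analytically to `ℂ₊ᵏ`, with label-uniform explicit local bounds.

## References

* K. Osterwalder, R. Schrader, *Axioms for Euclidean Green's functions II*, Comm. Math. Phys. 42
  (1975) 281–305, §IV.2 Thm. 4.2, Ch. V (5.2)–(5.4), (5.7)–(5.8), (5.15)–(5.19), Lemma 5.2,
  Ch. VI.2 (6.20)–(6.23), (6.28). [OsterwalderSchraderCMP1975]
-/

noncomputable section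

open Metric Set Filter Complex
open scoped Topology ComplexConjugate InnerProductSpace

namespace Literature.MathematicalPhysics.QuantumFieldTheory.OSEnvelope

open Literature.Analysis.Complex Literature.MathematicalPhysics.QuantumFieldTheory
  Literature.MathematicalPhysics.QuantumFieldTheory.LogSlot

variable {E : Type*} {H : Type*} [NormedAddCommGroup H] [InnerProductSpace ℂ H]

/-! ### The real-point hypotheses -/

/-- **Real-point data of OS II, labelled**: the Gram identities (5.2)/(5.17) at positive real points
for all labels and all splits (OS's (P₀), pointwise), and, for the good labels, continuity of
`ρ ↦ S₀ k c ρ` on the positive orthant (Thm. 4.1) and the real-point growth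
`‖S₀ k c ρ‖ ≤ C₀ k Π(ρ)^{p₀ k}` ((4.5)/(6.20), uniform over the good labels). [cite: OsterwalderSchraderCMP1975, Thm. 4.1, Ch. V (5.2), Ch. V.2 (5.17)–(5.19), Ch. VI.2 (6.20)] -/
structure IsOSLabelledRealData (good : (k : ℕ) → (Fin (k + 1) → E) → Prop)
    (S₀ : (k : ℕ) → (Fin (k + 1) → E) → (Fin k → ℂ) → ℂ)
    (Φ : (n : ℕ) → (Fin (n + 1) → E) → ℝ → (Fin n → ℝ) → H) (C₀ : ℕ → ℝ) (p₀ : ℕ → ℕ) : Prop where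
  gram : ∀ (k : ℕ) (c : Fin (k + 1) → E) (p : Fin k) (ρ : Fin k → ℝ), (∀ i, 0 < ρ i) →
    ∀ x' x : ℝ, 0 < x' → 0 < x → x' + x = ρ p →
      ⟪Φ p (posRevLeft c p) x' (blockRevLeft ρ p), Φ (k - 1 - p) (posRight c p) x (blockRight ρ p)⟫_ℂ =
        S₀ k c (fun i => (ρ i : ℂ))
  cont : ∀ (k : ℕ) (c : Fin (k + 1) → E), good k c →
    ContinuousOn (fun ρ : Fin k → ℝ => S₀ k c fun i => (ρ i : ℂ)) {ρ | ∀ i, 0 < ρ i}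
  C₀_nonneg : ∀ k, 0 ≤ C₀ k
  bound : ∀ (k : ℕ) (c : Fin (k + 1) → E), good k c → ∀ ρ : Fin k → ℝ, (∀ i, 0 < ρ i) →
    ‖S₀ k c (fun i => (ρ i : ℂ))‖ ≤ C₀ k * gFactor (fun i => (ρ i : ℂ)) ^ p₀ k

/-! ### Gram kernel, norms and continuity of the real-point vectors -/

section RealVectors

variable {good : (k : ℕ) → (Fin (k + 1) → E) → Prop} {S₀ : (k : ℕ) → (Fin (k + 1) → E) → (Fin k → ℂ) → ℂ}
  {Φ : (n : ℕ) → (Fin (n + 1) → E) → ℝ → (Fin n → ℝ) → H} {C₀ : ℕ → ℝ} {p₀ : ℕ → ℕ}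

/-- **The Gram kernel of the real-point vectors**: `⟪Φ m a x η', Φ m a x η⟫ = S₀ (2m+1) (dblPos a) (η', 2x, η)`. [cite: OsterwalderSchraderCMP1975, Ch. V.2 (5.17)] -/
theorem IsOSLabelledRealData.gram_diag (hD : IsOSLabelledRealData good S₀ Φ C₀ p₀) (m : ℕ) (a : Fin (m + 1) → E)
    {x : ℝ} (hx : 0 < x) (η η' : Fin m → ℝ) (hη : ∀ i, 0 < η i) (hη' : ∀ i, 0 < η' i) :
    ⟪Φ m a x η', Φ m a x η⟫_ℂ =
      S₀ (m + 1 + m) (dblPos a) (cDiagEmbed (fun i => (η' i : ℂ)) ((2 * x : ℝ) : ℂ) (fun i => (η i : ℂ))) := by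
  set ρ : Fin (m + 1 + m) → ℝ := cPlace η' (2 * x) η with hρ
  have hρpos : ∀ i, 0 < ρ i := by
    intro i
    rcases lt_trichotomy (i : ℕ) m with h | h | h
    · rw [hρ, cPlace_apply_lt _ _ _ h]; exact hη' _
    · rw [hρ, cPlace_apply_mid _ _ _ h]; positivity
    · rw [hρ, cPlace_apply_gt _ _ _ h]; exact hη _
  have h := hD.gram (m + 1 + m) (dblPos a) (midPos m m) ρ hρpos x x hx hx (by rw [hρ, cPlace_midPos]; ring)
  have hleft : blockRevLeft ρ (midPos m m) = η' := blockRevLeft_cPlace _ _ _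
  have hsize : m + 1 + m - 1 - ((midPos m m : Fin (m + 1 + m)) : ℕ) = m := by simp
  have hright : Φ (m + 1 + m - 1 - ((midPos m m : Fin (m + 1 + m)) : ℕ)) (posRight (dblPos a) (midPos m m)) x
      (blockRight ρ (midPos m m)) = Φ m a x η :=
    vecL_congr Φ hsize _ _ (fun i => by rw [posRight_dblPos]; rfl) x _ _ fun i => by
      rw [hρ, blockRight_cPlace]; rfl
  rw [hleft, posRevLeft_dblPos, hright] at h
  have h' : ⟪Φ m a x η', Φ m a x η⟫_ℂ = S₀ (m + 1 + m) (dblPos a) (fun i => (ρ i : ℂ)) := h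
  rw [h', cDiagEmbed_eq_cPlace, ← cPlace_map (fun r : ℝ => (r : ℂ))]

/-- **Norms of the real-point vectors**: `‖Φ m a x η‖² = Re S₀ (2m+1) (dblPos a) (η, 2x, η)`. [cite: OsterwalderSchraderCMP1975, Ch. V.2 (5.17), (5.21)] -/
theorem IsOSLabelledRealData.norm_sq_vec (hD : IsOSLabelledRealData good S₀ Φ C₀ p₀) (m : ℕ) (a : Fin (m + 1) → E)
    {x : ℝ} (hx : 0 < x) (η : Fin m → ℝ) (hη : ∀ i, 0 < η i) :
    ‖Φ m a x η‖ ^ 2 =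
      (S₀ (m + 1 + m) (dblPos a) (cDiagEmbed (fun i => (η i : ℂ)) ((2 * x : ℝ) : ℂ) (fun i => (η i : ℂ)))).re := by
  rw [← hD.gram_diag m a hx η η hη hη, inner_self_eq_norm_sq_to_K]
  norm_cast

/-- **Continuity from a continuous Gram kernel**: if `⟪Ψ η', Ψ η⟫ = K η' η` on `U` with `K` jointly
continuous on `U × U`, then `Ψ` is norm continuous on `U`. [folklore] -/
theorem continuousOn_of_gram {X : Type*} [TopologicalSpace X] {U : Set X} {Ψ : X → H} {K : X → X → ℂ}
    (hK : ∀ η ∈ U, ∀ η' ∈ U, ⟪Ψ η', Ψ η⟫_ℂ = K η' η)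
    (hKc : ContinuousOn (fun q : X × X => K q.1 q.2) (U ×ˢ U)) : ContinuousOn Ψ U := by
  intro η₀ hη₀
  -- the squared distance through the kernel
  set f : X → ℂ := fun η => K η η - K η η₀ - K η₀ η + K η₀ η₀ with hf
  have hdist : ∀ η ∈ U, ‖Ψ η - Ψ η₀‖ ^ 2 = (f η).re := by
    intro η hη
    have h1 : (⟪Ψ η - Ψ η₀, Ψ η - Ψ η₀⟫_ℂ).re = ‖Ψ η - Ψ η₀‖ ^ 2 := by
      rw [inner_self_eq_norm_sq_to_K]; norm_cast
    rw [← h1, inner_sub_left, inner_sub_right, inner_sub_right, hK η hη η hη, hK η₀ hη₀ η hη,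
      hK η hη η₀ hη₀, hK η₀ hη₀ η₀ hη₀, hf]
    congr 1
    ring
  -- `f` is continuous within `U` at `η₀` with `f η₀ = 0`
  have hmaps : ∀ (g : X → X × X), Continuous g → (∀ η ∈ U, g η ∈ U ×ˢ U) → g η₀ ∈ U ×ˢ U →
      ContinuousWithinAt (fun η => K (g η).1 (g η).2) U η₀ := fun g hg hgU hg₀ =>
    (hKc.continuousWithinAt hg₀).comp hg.continuousWithinAt fun η hη => hgU η hη
  have hc1 := hmaps (fun η => (η, η)) (continuous_id.prodMk continuous_id) (fun η hη => ⟨hη, hη⟩) ⟨hη₀, hη₀⟩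
  have hc2 := hmaps (fun η => (η, η₀)) (continuous_id.prodMk continuous_const) (fun η hη => ⟨hη, hη₀⟩) ⟨hη₀, hη₀⟩
  have hc3 := hmaps (fun η => (η₀, η)) (continuous_const.prodMk continuous_id) (fun η hη => ⟨hη₀, hη⟩) ⟨hη₀, hη₀⟩
  have hfc : ContinuousWithinAt f U η₀ := ((hc1.sub hc2).sub hc3).add continuousWithinAt_const
  have hf0 : f η₀ = 0 := by simp [hf]
  have hre : Tendsto (fun η => (f η).re) (𝓝[U] η₀) (𝓝 0) := by
    have := (Complex.continuous_re.continuousAt.tendsto.comp hfc.tendsto)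
    rwa [Function.comp_def, hf0, Complex.zero_re] at this
  -- hence the norm of the difference tends to zero
  have hsq : Tendsto (fun η => ‖Ψ η - Ψ η₀‖ ^ 2) (𝓝[U] η₀) (𝓝 0) :=
    hre.congr' (eventually_nhdsWithin_of_forall fun η hη => (hdist η hη).symm)
  have hnorm : Tendsto (fun η => ‖Ψ η - Ψ η₀‖) (𝓝[U] η₀) (𝓝 0) := by
    have h := (Real.continuous_sqrt.tendsto 0).comp hsq
    rw [Real.sqrt_zero] at h
    refine h.congr' (Eventually.of_forall fun η => ?_)
    simp [Real.sqrt_sq (norm_nonneg _)]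
  exact tendsto_iff_norm_sub_tendsto_zero.2 hnorm

/-- The Gram point map `(η', η) ↦ (η', 2x, η)` is continuous. [folklore] -/
theorem continuous_cPlace_pair (m : ℕ) (t : ℝ) :
    Continuous fun q : (Fin m → ℝ) × (Fin m → ℝ) => cPlace q.1 t q.2 := by
  refine continuous_pi fun i => ?_
  rcases lt_trichotomy (i : ℕ) m with h | h | h
  · simp only [cPlace_apply_lt _ _ _ h]; exact (continuous_apply _).comp continuous_fst
  · simp only [cPlace_apply_mid _ _ _ h]; exact continuous_const
  · simp only [cPlace_apply_gt _ _ _ h]; exact (continuous_apply _).comp continuous_snd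

/-- **Continuity of the real-point vectors** `ξ ↦ Φ m a x ξ` on the positive orthant, for labels with
good doubled label (from the continuity of `S₀` at the doubled label). [cite: OsterwalderSchraderCMP1975, Ch. V.2 p. 294 ("Continuity … will be evident at each step")] -/
theorem IsOSLabelledRealData.continuousOn_vec (hD : IsOSLabelledRealData good S₀ Φ C₀ p₀) (m : ℕ)
    {a : Fin (m + 1) → E} (ha : good (m + 1 + m) (dblPos a)) {x : ℝ} (hx : 0 < x) :
    ContinuousOn (Φ m a x) {ξ : Fin m → ℝ | ∀ i, 0 < ξ i} := by
  refine continuousOn_of_gram (K := fun η' η => S₀ (m + 1 + m) (dblPos a)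
    (cDiagEmbed (fun i => (η' i : ℂ)) ((2 * x : ℝ) : ℂ) (fun i => (η i : ℂ))))
    (fun η hη η' hη' => hD.gram_diag m a hx η η' hη hη') ?_
  -- the kernel is `S₀` at the Gram point, a continuous function of `(η', η)`
  have hK : (fun q : (Fin m → ℝ) × (Fin m → ℝ) => S₀ (m + 1 + m) (dblPos a)
      (cDiagEmbed (fun i => (q.1 i : ℂ)) ((2 * x : ℝ) : ℂ) (fun i => (q.2 i : ℂ)))) =
      (fun ρ : Fin (m + 1 + m) → ℝ => S₀ (m + 1 + m) (dblPos a) fun i => (ρ i : ℂ)) ∘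
        fun q => cPlace q.1 (2 * x) q.2 := by
    funext q
    simp only [Function.comp_apply, cDiagEmbed_eq_cPlace, ← cPlace_map (fun r : ℝ => (r : ℂ))]
  rw [hK]
  refine (hD.cont _ _ ha).comp (continuous_cPlace_pair m (2 * x)).continuousOn fun q hq i => ?_
  rcases lt_trichotomy (i : ℕ) m with h | h | h
  · rw [cPlace_apply_lt _ _ _ h]; exact hq.1 _
  · rw [cPlace_apply_mid _ _ _ h]; positivity
  · rw [cPlace_apply_gt _ _ _ h]; exact hq.2 _

end RealVectors

/-! ### The one-gap continuations (5.4) -/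

section Slots

variable {m : ℕ}

/-- **The real left block of the slot `i`**: the reversed gaps before `i`, `(u'_{i-1}, …, u'_0)`. [folklore] -/
def Lr (i : Fin (m + 1)) (u' : Fin m → ℝ) : Fin i → ℝ := fun j => u' ⟨i - 1 - j, by omega⟩

/-- **The real right block of the slot `i`**: the gaps after `i`, `(u'_i, …, u'_{m-1})`. [folklore] -/
def Rr (i : Fin (m + 1)) (u' : Fin m → ℝ) : Fin (m + 1 - 1 - i) → ℝ :=
  fun j => u' ⟨i + j, by have := j.2; omega⟩

/-- The reversed left block of `insertNth i t u'` at `i` is `Lr i u'`. [folklore] -/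
theorem blockRevLeft_insertNth {α : Type*} (i : Fin (m + 1)) (t : α) (u' : Fin m → α) (j : Fin i) :
    blockRevLeft (i.insertNth t u' : Fin (m + 1) → α) i j = u' ⟨i - 1 - j, by omega⟩ := by
  rw [blockRevLeft_apply]
  have hidx : (⟨(i : ℕ) - 1 - j, by have := i.2; omega⟩ : Fin (m + 1)) =
      i.succAbove ⟨i - 1 - j, by omega⟩ := by
    rw [Fin.succAbove_of_castSucc_lt _ _ (by rw [Fin.lt_def]; simp; omega)]
    rfl
  rw [hidx, Fin.insertNth_apply_succAbove]

/-- The right block of `insertNth i t u'` at `i` is `Rr i u'`. [folklore] -/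
theorem blockRight_insertNth {α : Type*} (i : Fin (m + 1)) (t : α) (u' : Fin m → α) (j : Fin (m + 1 - 1 - i)) :
    blockRight (i.insertNth t u' : Fin (m + 1) → α) i j = u' ⟨i + j, by have := j.2; omega⟩ := by
  rw [blockRight_apply]
  have hidx : (⟨(i : ℕ) + 1 + j, by have := j.2; omega⟩ : Fin (m + 1)) =
      i.succAbove ⟨i + j, by have := j.2; omega⟩ := by
    rw [Fin.succAbove_of_le_castSucc _ _ (by rw [Fin.le_def]; simp)]
    ext; simp; omega
  rw [hidx, Fin.insertNth_apply_succAbove]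

/-- The reversed left block of the real full vector. [folklore] -/
theorem blockRevLeft_insertNth_real (i : Fin (m + 1)) (t : ℝ) (u' : Fin m → ℝ) :
    blockRevLeft (i.insertNth t u' : Fin (m + 1) → ℝ) i = Lr i u' :=
  funext fun j => blockRevLeft_insertNth i t u' j

/-- The right block of the real full vector. [folklore] -/
theorem blockRight_insertNth_real (i : Fin (m + 1)) (t : ℝ) (u' : Fin m → ℝ) :
    blockRight (i.insertNth t u' : Fin (m + 1) → ℝ) i = Rr i u' :=
  funext fun j => blockRight_insertNth i t u' j

/-- The reversed left block of the complex full vector is real. [folklore] -/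
theorem blockRevLeft_insertNth_complex (i : Fin (m + 1)) (τ : ℂ) (u' : Fin m → ℝ) :
    blockRevLeft (i.insertNth (α := fun _ => ℂ) τ fun j => (u' j : ℂ)) i = fun j => (Lr i u' j : ℂ) :=
  funext fun j => blockRevLeft_insertNth i τ (fun j => (u' j : ℂ)) j

/-- The right block of the complex full vector is real. [folklore] -/
theorem blockRight_insertNth_complex (i : Fin (m + 1)) (τ : ℂ) (u' : Fin m → ℝ) :
    blockRight (i.insertNth (α := fun _ => ℂ) τ fun j => (u' j : ℂ)) i = fun j => (Rr i u' j : ℂ) :=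
  funext fun j => blockRight_insertNth i τ (fun j => (u' j : ℂ)) j

/-- Positivity of the blocks. [folklore] -/
theorem Lr_pos (i : Fin (m + 1)) {u' : Fin m → ℝ} (hu : ∀ j, 0 < u' j) (j : Fin i) : 0 < Lr i u' j := hu _

/-- Positivity of the blocks. [folklore] -/
theorem Rr_pos (i : Fin (m + 1)) {u' : Fin m → ℝ} (hu : ∀ j, 0 < u' j) (j : Fin (m + 1 - 1 - i)) : 0 < Rr i u' j :=
  hu _

/-- Continuity of the blocks in the gaps. [folklore] -/
theorem continuous_Lr (i : Fin (m + 1)) : Continuous (Lr i : (Fin m → ℝ) → Fin i → ℝ) :=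
  continuous_pi fun _ => continuous_apply _

/-- Continuity of the blocks in the gaps. [folklore] -/
theorem continuous_Rr (i : Fin (m + 1)) : Continuous (Rr i : (Fin m → ℝ) → Fin (m + 1 - 1 - i) → ℝ) :=
  continuous_pi fun _ => continuous_apply _

variable (T : ℂ → H →L[ℂ] H) (Φ : (n : ℕ) → (Fin (n + 1) → E) → ℝ → (Fin n → ℝ) → H)

/-- **The one-gap continuation at the slot `i`** ((5.4) with the canonical split
`x' = x = Re τ/4`, `τ' = τ - Re τ/2`):
`E_i(u', τ) = ⟪Φ i (c_i, …, c_0) (Re τ/4) (Lr i u'), T (τ - Re τ/2) (Φ (m-i) (c_{i+1}, …) (Re τ/4) (Rr i u'))⟫`. [cite: OsterwalderSchraderCMP1975, Ch. V eq. (5.4)] -/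
def slotE (c : Fin (m + 1 + 1) → E) (i : Fin (m + 1)) (u' : Fin m → ℝ) (τ : ℂ) : ℂ :=
  ⟪Φ i (posRevLeft c i) (τ.re / 4) (Lr i u'),
    T (τ - ((τ.re / 2 : ℝ) : ℂ)) (Φ (m + 1 - 1 - i) (posRight c i) (τ.re / 4) (Rr i u'))⟫_ℂ

variable {T Φ} {CT : ℝ} {good : (k : ℕ) → (Fin (k + 1) → E) → Prop}
  {S₀ : (k : ℕ) → (Fin (k + 1) → E) → (Fin k → ℂ) → ℂ} {C₀ : ℕ → ℝ} {p₀ : ℕ → ℕ}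

/-- **The one-gap continuation at a real gap is the Schwinger function** ((5.2) pointwise): for
`u' > 0`, `x > 0`, `E_i(u', x) = S₀ (m+1) c (u'_0, …, x, …, u'_{m-1})`. [cite: OsterwalderSchraderCMP1975, Ch. V (5.2), (5.4)] -/
theorem slotE_ofReal (hΦ : IsOSLabelledVectors T Φ)
    (hD : IsOSLabelledRealData good S₀ Φ C₀ p₀) (c : Fin (m + 1 + 1) → E) (i : Fin (m + 1))
    {u' : Fin m → ℝ} (hu : ∀ j, 0 < u' j) {x : ℝ} (hx : 0 < x) :
    slotE T Φ c i u' x = S₀ (m + 1) c (fun j => ((i.insertNth x u' : Fin (m + 1) → ℝ) j : ℂ)) := by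
  rw [slotE, Complex.ofReal_re]
  have hτ : (x : ℂ) - ((x / 2 : ℝ) : ℂ) = ((x / 2 : ℝ) : ℂ) := by push_cast; ring
  rw [hτ, hΦ.shift _ _ (x / 4) (x / 2) (by positivity) (by positivity) _ (Rr_pos i hu)]
  have hρpos : ∀ j, 0 < (i.insertNth x u' : Fin (m + 1) → ℝ) j := by
    intro j
    refine Fin.succAboveCases i ?_ (fun j' => ?_) j
    · rw [Fin.insertNth_apply_same]; exact hx
    · rw [Fin.insertNth_apply_succAbove]; exact hu j'
  have h := hD.gram (m + 1) c i (i.insertNth x u') hρpos (x / 4) (x / 4 + x / 2) (by positivity) (by positivity)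
    (by rw [Fin.insertNth_apply_same]; ring)
  rw [blockRevLeft_insertNth_real, blockRight_insertNth_real] at h
  exact h

/-- **Holomorphy of the one-gap continuation** on `{Re τ > 0}` (the generating function of
`OSGeneratingFunction` with no complex block variables). [cite: OsterwalderSchraderCMP1975, Ch. V eq. (5.4)] -/
theorem differentiableOn_slotE [CompleteSpace H] (hT : IsOSSemigroup T CT) (hΦ : IsOSLabelledVectors T Φ)
    (c : Fin (m + 1 + 1) → E) (i : Fin (m + 1)) {u' : Fin m → ℝ} (hu : ∀ j, 0 < u' j) :
    DifferentiableOn ℂ (slotE T Φ c i u') {τ : ℂ | 0 < τ.re} := by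
  -- the generating function with `m₁ = m₂ = 0`
  set Ψ₁ : ℝ → (Fin 0 → ℂ) → H := fun x _ => Φ i (posRevLeft c i) x (Lr i u') with hΨ₁
  set Ψ₂ : ℝ → (Fin 0 → ℂ) → H := fun x _ => Φ (m + 1 - 1 - i) (posRight c i) x (Rr i u') with hΨ₂
  obtain ⟨G, hGd, hGsplit⟩ := exists_generatingFunction (m₁ := 0) (m₂ := 0) (U₁ := univ) (U₂ := univ)
    (Ψ₁ := Ψ₁) (Ψ₂ := Ψ₂) hT.weakHolo ⟨CT, hT.norm_le⟩ hT.law hT.symm isOpen_univ isOpen_univ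
    (fun x _ => differentiableOn_const _) (fun x _ => differentiableOn_const _)
    (fun x t hx ht _ _ => hΦ.shift _ _ x t hx ht _ (Lr_pos i hu))
    (fun x t hx ht _ _ => hΦ.shift _ _ x t hx ht _ (Rr_pos i hu))
  set e : Fin 0 → ℂ := fun j => j.elim0 with he
  have hemb : Differentiable ℂ fun τ : ℂ => (e, τ, e) :=
    (differentiable_const e).prodMk (differentiable_id.prodMk (differentiable_const e))
  have heq : EqOn (slotE T Φ c i u') (fun τ => G (e, τ, e)) {τ : ℂ | 0 < τ.re} := by
    intro τ hτ
    have hτ' : 0 < τ.re := hτ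
    have hsplit := hGsplit e τ e (mem_univ _) (mem_univ _) (τ.re / 4) (τ.re / 4) (τ - ((τ.re / 2 : ℝ) : ℂ))
      (by positivity) (by positivity) (by simp; linarith) (by push_cast; ring)
    show slotE T Φ c i u' τ = G (e, τ, e)
    rw [hsplit]
    rfl
  refine DifferentiableOn.congr (hGd.comp hemb.differentiableOn fun τ hτ => ?_) heq
  exact ⟨by rw [show star e = e from funext fun j => j.elim0]; exact mem_univ _, hτ, mem_univ _⟩

/-- **Continuity of the one-gap continuation in the other gaps** on the positive orthant (fixed `τ`
with `Re τ > 0`), for a label whose parts have good doubled labels. [cite: OsterwalderSchraderCMP1975, Ch. V.2 p. 294] -/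
theorem continuousOn_slotE (hD : IsOSLabelledRealData good S₀ Φ C₀ p₀) (hgood : IsOSLabelSet good)
    {c : Fin (m + 1 + 1) → E} (hc : good (m + 1) c) (i : Fin (m + 1)) {τ : ℂ} (hτ : 0 < τ.re) :
    ContinuousOn (fun u' : Fin m → ℝ => slotE T Φ c i u' τ) {u' | ∀ j, 0 < u' j} := by
  have hx : 0 < τ.re / 4 := by positivity
  have hL := (hD.continuousOn_vec i (hgood.left (m + 1) c i hc) hx).comp (continuous_Lr i).continuousOn
    fun u' hu j => Lr_pos i hu j
  have hR := (hD.continuousOn_vec (m + 1 - 1 - i) (hgood.right (m + 1) c i hc) hx).comp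
    (continuous_Rr i).continuousOn fun u' hu j => Rr_pos i hu j
  exact ContinuousOn.inner hL ((T _).continuous.comp_continuousOn hR)

end Slots

/-! ### The Schwarz bound for the one-gap continuations on closed sectors -/

section SlotBounds

variable {m : ℕ} {T : ℂ → H →L[ℂ] H} {CT : ℝ}
  {Φ : (n : ℕ) → (Fin (n + 1) → E) → ℝ → (Fin n → ℝ) → H}
  {good : (k : ℕ) → (Fin (k + 1) → E) → Prop} {S₀ : (k : ℕ) → (Fin (k + 1) → E) → (Fin k → ℂ) → ℂ}
  {C₀ : ℕ → ℝ} {p₀ : ℕ → ℕ}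

/-- **The constant of the Schwarz bound for the one-gap continuation at the slot `p`** (as
`pieceConst`, with the real-point constants `C₀`): explicit in `(CT, C₀, p₀, k, p, c₀ = cos θ)`. [folklore] -/
def zslotConst (CT : ℝ) (C₀ : ℕ → ℝ) (p₀ : ℕ → ℕ) (k : ℕ) (p : Fin k) (c₀ : ℝ) : ℝ :=
  max CT 0 / 2 *
    (max (C₀ (p + 1 + p)) 0 * (1 + 2 / c₀) ^ ((p + 1 + p) * p₀ (p + 1 + p)) +
      max (C₀ (k - 1 - p + 1 + (k - 1 - p))) 0 *
        (1 + 2 / c₀) ^ ((k - 1 - p + 1 + (k - 1 - p)) * p₀ (k - 1 - p + 1 + (k - 1 - p))))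

/-- `zslotConst ≥ 0` for `c₀ > 0`. [folklore] -/
theorem zslotConst_nonneg (CT : ℝ) (C₀ : ℕ → ℝ) (p₀ : ℕ → ℕ) (k : ℕ) (p : Fin k) {c₀ : ℝ} (hc₀ : 0 < c₀) :
    0 ≤ zslotConst CT C₀ p₀ k p c₀ := by
  unfold zslotConst
  have hA : 0 ≤ 1 + 2 / c₀ := by positivity
  have := le_max_right CT 0
  have := le_max_right (C₀ (p + 1 + p)) 0
  have := le_max_right (C₀ (k - 1 - p + 1 + (k - 1 - p))) 0
  positivity

open Classical in
/-- **The sector constant at level `0`**: the sum over the slots of the Schwarz constants at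
`cos (max c 0)` (for `c < π/2`; `0` otherwise). [folklore] -/
def zCsec (CT : ℝ) (C₀ : ℕ → ℝ) (p₀ : ℕ → ℕ) (k : ℕ) (c : ℝ) : ℝ :=
  if c < Real.pi / 2 then ∑ p : Fin k, zslotConst CT C₀ p₀ k p (Real.cos (max c 0)) else 0

/-- Positivity of `cos (max c 0)` for `c < π/2`. [folklore] -/
theorem cos_max_pos {c : ℝ} (hc : c < Real.pi / 2) : 0 < Real.cos (max c 0) :=
  Real.cos_pos_of_mem_Ioo ⟨by have := le_max_right c 0; linarith [Real.pi_pos], max_lt hc (by positivity)⟩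

/-- `zCsec ≥ 0`. [folklore] -/
theorem zCsec_nonneg (CT : ℝ) (C₀ : ℕ → ℝ) (p₀ : ℕ → ℕ) (k : ℕ) (c : ℝ) : 0 ≤ zCsec CT C₀ p₀ k c := by
  unfold zCsec
  split_ifs with hc
  · exact Finset.sum_nonneg fun p _ => zslotConst_nonneg CT C₀ p₀ k p (cos_max_pos hc)
  · exact le_rfl

/-- A single Schwarz constant is bounded by the sector constant. [folklore] -/
theorem zslotConst_le_zCsec (CT : ℝ) (C₀ : ℕ → ℝ) (p₀ : ℕ → ℕ) {k : ℕ} (p : Fin k) {c : ℝ} (hc : c < Real.pi / 2) :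
    zslotConst CT C₀ p₀ k p (Real.cos (max c 0)) ≤ zCsec CT C₀ p₀ k c := by
  rw [zCsec, if_pos hc]
  exact Finset.single_le_sum (f := fun q => zslotConst CT C₀ p₀ k q (Real.cos (max c 0)))
    (fun q _ => zslotConst_nonneg CT C₀ p₀ k q (cos_max_pos hc)) (Finset.mem_univ p)

/-- **`Π` of the full vector**: `Π(u'_0, …, τ, …) = (|τ| + |τ|⁻¹) Π(u')`. [folklore] -/
theorem gFactor_insertNth (i : Fin (m + 1)) (τ : ℂ) (Z' : Fin m → ℂ) :
    gFactor (i.insertNth (α := fun _ => ℂ) τ Z') = (‖τ‖ + ‖τ‖⁻¹) * gFactor Z' := by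
  unfold gFactor
  rw [Fin.prod_univ_succAbove _ i, Fin.insertNth_apply_same]
  simp only [Fin.insertNth_apply_succAbove]

/-- The Gram point of a real block is the complex placement of the conjugated block. [folklore] -/
theorem cDiagEmbed_ofReal_eq {n : ℕ} (ξ : Fin n → ℝ) (t : ℝ) :
    cDiagEmbed (fun j => (ξ j : ℂ)) (t : ℂ) (fun j => (ξ j : ℂ)) =
      cDiagEmbed (star fun j => (ξ j : ℂ)) (t : ℂ) (fun j => (ξ j : ℂ)) := by
  congr 1
  funext j
  simp [Pi.star_apply, Complex.conj_ofReal]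

/-- **Squared norms of the real-point vectors through the real-point growth**:
`‖Φ n a x ξ‖² ≤ max (C₀ (2n+1)) 0 · Π(ξ, 2x, ξ)^{p₀ (2n+1)}` for labels with good doubled label. [cite: OsterwalderSchraderCMP1975, Ch. VI.2 (6.20), (6.22)] -/
theorem IsOSLabelledRealData.norm_sq_vec_le (hD : IsOSLabelledRealData good S₀ Φ C₀ p₀) (n : ℕ)
    {a : Fin (n + 1) → E} (ha : good (n + 1 + n) (dblPos a)) {x : ℝ} (hx : 0 < x) {ξ : Fin n → ℝ}
    (hξ : ∀ j, 0 < ξ j) :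
    ‖Φ n a x ξ‖ ^ 2 ≤ max (C₀ (n + 1 + n)) 0 *
      gFactor (cDiagEmbed (fun j => (ξ j : ℂ)) ((2 * x : ℝ) : ℂ) (fun j => (ξ j : ℂ))) ^ p₀ (n + 1 + n) := by
  rw [hD.norm_sq_vec n a hx ξ hξ]
  -- the Gram point is a positive real vector
  set ρ : Fin (n + 1 + n) → ℝ := cPlace ξ (2 * x) ξ with hρ
  have hρpos : ∀ i, 0 < ρ i := by
    intro i
    rcases lt_trichotomy (i : ℕ) n with h | h | h
    · rw [hρ, cPlace_apply_lt _ _ _ h]; exact hξ _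
    · rw [hρ, cPlace_apply_mid _ _ _ h]; positivity
    · rw [hρ, cPlace_apply_gt _ _ _ h]; exact hξ _
  have hpt : cDiagEmbed (fun j => (ξ j : ℂ)) ((2 * x : ℝ) : ℂ) (fun j => (ξ j : ℂ)) = fun i => (ρ i : ℂ) := by
    rw [cDiagEmbed_eq_cPlace, ← cPlace_map (fun r : ℝ => (r : ℂ))]
  rw [hpt]
  exact (Complex.re_le_norm _).trans ((hD.bound _ _ ha ρ hρpos).trans
    (mul_le_mul_of_nonneg_right (le_max_left _ _) (pow_nonneg (gFactor_nonneg _) _)))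

/-- **The Schwarz bound (6.22)–(6.23) for the one-gap continuation on a closed sector**: for a good
label, `u' > 0`, `Re τ > 0` and `|arg τ| ≤ θ < π/2`,
`‖E_i(u', τ)‖ ≤ zslotConst · Π(u'_0, …, τ, …)^{pieceExp}`. [cite: OsterwalderSchraderCMP1975, Ch. VI.2 (6.22)–(6.23)] -/
theorem norm_slotE_le (hT : IsOSSemigroup T CT) (hD : IsOSLabelledRealData good S₀ Φ C₀ p₀)
    (hgood : IsOSLabelSet good) {c : Fin (m + 1 + 1) → E} (hc : good (m + 1) c) (i : Fin (m + 1))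
    {θ : ℝ} (hθ0 : 0 ≤ θ) (hθ : θ < Real.pi / 2) {u' : Fin m → ℝ} (hu : ∀ j, 0 < u' j) {τ : ℂ} (hτ : 0 < τ.re)
    (hτθ : |τ.arg| ≤ θ) :
    ‖slotE T Φ c i u' τ‖ ≤ zslotConst CT C₀ p₀ (m + 1) i (Real.cos θ) *
      gFactor (i.insertNth (α := fun _ => ℂ) τ fun j => (u' j : ℂ)) ^ pieceExp p₀ (m + 1) i := by
  -- the labels of the two parts are good after doubling
  have hl : good (i + 1 + i) (dblPos (posRevLeft c i)) := hgood.left (m + 1) c i hc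
  have hr : good (m + 1 - 1 - i + 1 + (m + 1 - 1 - i)) (dblPos (posRight c i)) := hgood.right (m + 1) c i hc
  set Z : Fin (m + 1) → ℂ := i.insertNth (α := fun _ => ℂ) τ fun j => (u' j : ℂ) with hZ
  have hτ0 : τ ≠ 0 := fun h => by rw [h] at hτ; simp at hτ
  have hZne : ∀ j, Z j ≠ 0 := by
    intro j
    refine Fin.succAboveCases i ?_ (fun j' => ?_) j
    · rw [hZ, Fin.insertNth_apply_same]; exact hτ0
    · rw [hZ, Fin.insertNth_apply_succAbove]; exact_mod_cast (hu j').ne'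
  have hc₀ : 0 < Real.cos θ := Real.cos_pos_of_mem_Ioo ⟨by linarith [Real.pi_pos], hθ⟩
  have hre : ‖τ‖ * Real.cos θ ≤ τ.re := norm_mul_cos_le_re_of_abs_arg_le hθ.le hτθ
  -- the split
  set x : ℝ := τ.re / 4 with hx
  have hx0 : 0 < x := by positivity
  set τ' : ℂ := τ - ((τ.re / 2 : ℝ) : ℂ) with hτ'
  have hτ're : 0 < τ'.re := by simp only [hτ', Complex.sub_re, Complex.ofReal_re]; linarith
  have hslot : slotE T Φ c i u' τ =
      ⟪Φ i (posRevLeft c i) x (Lr i u'), T τ' (Φ (m + 1 - 1 - i) (posRight c i) x (Rr i u'))⟫_ℂ := rfl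
  rw [hslot]
  -- Schwarz
  set a : ℝ := ‖Φ i (posRevLeft c i) x (Lr i u')‖ with ha
  set b : ℝ := ‖Φ (m + 1 - 1 - i) (posRight c i) x (Rr i u')‖ with hb
  have hSchwarz : ‖⟪Φ i (posRevLeft c i) x (Lr i u'), T τ' (Φ (m + 1 - 1 - i) (posRight c i) x (Rr i u'))⟫_ℂ‖ ≤
      max CT 0 * (a * b) := by
    calc ‖⟪Φ i (posRevLeft c i) x (Lr i u'), T τ' (Φ (m + 1 - 1 - i) (posRight c i) x (Rr i u'))⟫_ℂ‖
        ≤ a * ‖T τ' (Φ (m + 1 - 1 - i) (posRight c i) x (Rr i u'))‖ := norm_inner_le_norm _ _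
      _ ≤ a * (‖T τ'‖ * b) := mul_le_mul_of_nonneg_left ((T τ').le_opNorm _) (norm_nonneg _)
      _ ≤ a * (max CT 0 * b) := by
          refine mul_le_mul_of_nonneg_left (mul_le_mul_of_nonneg_right
            ((hT.norm_le τ' hτ're).trans (le_max_left _ _)) (norm_nonneg _)) (norm_nonneg _)
      _ = max CT 0 * (a * b) := by ring
  -- the two norms through the real-point growth at the doubled labels
  have h2x : 2 * x = τ.re / 2 := by rw [hx]; ring
  set wL : Fin i → ℂ := fun j => (Lr i u' j : ℂ) with hwL
  set wR : Fin (m + 1 - 1 - i) → ℂ := fun j => (Rr i u' j : ℂ) with hwR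
  have hwLZ : ∀ j, ∃ i', ‖wL j‖ = ‖Z i'‖ := fun j =>
    ⟨⟨i - 1 - j, by have := i.2; omega⟩, by
      simp only [hwL, Lr, hZ]
      rw [← blockRevLeft_insertNth i τ (fun j => (u' j : ℂ)) j, blockRevLeft_apply]⟩
  have hwRZ : ∀ j, ∃ i', ‖wR j‖ = ‖Z i'‖ := fun j =>
    ⟨⟨i + 1 + j, by have := j.2; omega⟩, by
      simp only [hwR, Rr, hZ]
      rw [← blockRight_insertNth i τ (fun j => (u' j : ℂ)) j, blockRight_apply]⟩
  have hζZ : ∃ i', τ = Z i' := ⟨i, by rw [hZ, Fin.insertNth_apply_same]⟩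
  set A : ℝ := 1 + 2 / Real.cos θ with hA
  set e₁ : ℕ := (i + 1 + i) * p₀ (i + 1 + i) with he₁
  set e₂ : ℕ := (m + 1 - 1 - i + 1 + (m + 1 - 1 - i)) * p₀ (m + 1 - 1 - i + 1 + (m + 1 - 1 - i)) with he₂
  set C₁ : ℝ := max (C₀ (i + 1 + i)) 0 with hC₁
  set C₂ : ℝ := max (C₀ (m + 1 - 1 - i + 1 + (m + 1 - 1 - i))) 0 with hC₂
  have ha2 : a ^ 2 ≤ C₁ * (A * gFactor Z) ^ e₁ := by
    have h := hD.norm_sq_vec_le i hl hx0 (Lr_pos i hu)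
    refine h.trans ?_
    rw [he₁, pow_mul]
    refine mul_le_mul_of_nonneg_left (pow_le_pow_left₀ (gFactor_nonneg _) ?_ _) (le_max_right _ _)
    rw [h2x, cDiagEmbed_ofReal_eq]
    exact gFactor_cDiagEmbed_le hZne hwLZ hζZ hc₀ hre hτ
  have hb2 : b ^ 2 ≤ C₂ * (A * gFactor Z) ^ e₂ := by
    have h := hD.norm_sq_vec_le (m + 1 - 1 - i) hr hx0 (Rr_pos i hu)
    refine h.trans ?_
    rw [he₂, pow_mul]
    refine mul_le_mul_of_nonneg_left (pow_le_pow_left₀ (gFactor_nonneg _) ?_ _) (le_max_right _ _)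
    rw [h2x, cDiagEmbed_ofReal_eq]
    exact gFactor_cDiagEmbed_le hZne hwRZ hζZ hc₀ hre hτ
  -- assemble
  have hab : a * b ≤ (a ^ 2 + b ^ 2) / 2 := by nlinarith [sq_nonneg (a - b)]
  have hpow₁ : (A * gFactor Z) ^ e₁ ≤ A ^ e₁ * gFactor Z ^ pieceExp p₀ (m + 1) i := by
    rw [mul_pow]
    exact mul_le_mul_of_nonneg_left (gFactor_pow_le_pow hZne (le_max_left _ _)) (by positivity)
  have hpow₂ : (A * gFactor Z) ^ e₂ ≤ A ^ e₂ * gFactor Z ^ pieceExp p₀ (m + 1) i := by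
    rw [mul_pow]
    exact mul_le_mul_of_nonneg_left (gFactor_pow_le_pow hZne (le_max_right _ _)) (by positivity)
  have hC₁0 : 0 ≤ C₁ := le_max_right _ _
  have hC₂0 : 0 ≤ C₂ := le_max_right _ _
  calc ‖⟪Φ i (posRevLeft c i) x (Lr i u'), T τ' (Φ (m + 1 - 1 - i) (posRight c i) x (Rr i u'))⟫_ℂ‖
      ≤ max CT 0 * (a * b) := hSchwarz
    _ ≤ max CT 0 * ((a ^ 2 + b ^ 2) / 2) := mul_le_mul_of_nonneg_left hab (le_max_right _ _)
    _ ≤ max CT 0 * ((C₁ * (A ^ e₁ * gFactor Z ^ pieceExp p₀ (m + 1) i) +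
          C₂ * (A ^ e₂ * gFactor Z ^ pieceExp p₀ (m + 1) i)) / 2) := by
        gcongr
        · exact ha2.trans (mul_le_mul_of_nonneg_left hpow₁ hC₁0)
        · exact hb2.trans (mul_le_mul_of_nonneg_left hpow₂ hC₂0)
    _ = zslotConst CT C₀ p₀ (m + 1) i (Real.cos θ) * gFactor Z ^ pieceExp p₀ (m + 1) i := by
        simp only [zslotConst, hC₁, hC₂, hA, he₁, he₂]
        ring

/-- **The real-point data of a good label are sector data of opening `π/2`** (constants
`C₀ (m+1)`, `stepExp p₀ (m+1)`, `zCsec`). [cite: OsterwalderSchraderCMP1975, Ch. V (5.4), (5.7); Ch. VI.2 (6.20)–(6.23)] -/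
theorem IsOSLabelledRealData.isSectorData [CompleteSpace H] (hT : IsOSSemigroup T CT)
    (hΦ : IsOSLabelledVectors T Φ) (hgood : IsOSLabelSet good) (hD : IsOSLabelledRealData good S₀ Φ C₀ p₀)
    {c : Fin (m + 1 + 1) → E} (hc : good (m + 1) c) :
    IsSectorData (Real.pi / 2) (fun u : Fin (m + 1) → ℝ => S₀ (m + 1) c fun j => (u j : ℂ)) (slotE T Φ c)
      (C₀ (m + 1)) (stepExp p₀ (m + 1)) (zCsec CT C₀ p₀ (m + 1)) where
  cont := hD.cont _ _ hc
  C₀_nonneg := hD.C₀_nonneg _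
  bound u hu := by
    have hne : ∀ j, ((u j : ℝ) : ℂ) ≠ 0 := fun j => by exact_mod_cast (hu j).ne'
    exact (hD.bound _ _ hc u hu).trans (mul_le_mul_of_nonneg_left
      (gFactor_pow_le_pow hne (le_max_left _ _)) (hD.C₀_nonneg _))
  slot_cont i τ hτ := continuousOn_slotE hD hgood hc i hτ.1
  slot_holo i u' hu := (differentiableOn_slotE hT hΦ c i hu).mono fun τ hτ => hτ.1
  Csec_nonneg := zCsec_nonneg CT C₀ p₀ (m + 1)
  slot_bound i c' hc' u' τ hu hτ hτc := by
    set θ : ℝ := max c' 0 with hθ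
    have hθ0 : 0 ≤ θ := le_max_right _ _
    have hθlt : θ < Real.pi / 2 := max_lt hc' (by positivity)
    have hb := norm_slotE_le hT hD hgood hc i hθ0 hθlt hu hτ (hτc.trans (le_max_left _ _))
    refine hb.trans ?_
    have hτ0 : τ ≠ 0 := fun h => by rw [h] at hτ; simp at hτ
    have hZne : ∀ j, (i.insertNth (α := fun _ => ℂ) τ fun j => (u' j : ℂ)) j ≠ 0 := by
      intro j
      refine Fin.succAboveCases i ?_ (fun j' => ?_) j
      · rw [Fin.insertNth_apply_same]; exact hτ0
      · rw [Fin.insertNth_apply_succAbove]; exact_mod_cast (hu j').ne'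
    have hexp : pieceExp p₀ (m + 1) i ≤ stepExp p₀ (m + 1) :=
      (Finset.le_sup (f := fun p : Fin (m + 1) => pieceExp p₀ (m + 1) p) (Finset.mem_univ i)).trans
        (le_max_right _ _)
    have hle : gFactor (i.insertNth (α := fun _ => ℂ) τ fun j => (u' j : ℂ)) ^ pieceExp p₀ (m + 1) i ≤
        gFactor (fun j => (u' j : ℂ)) ^ stepExp p₀ (m + 1) * (‖τ‖ + ‖τ‖⁻¹) ^ stepExp p₀ (m + 1) := by
      refine (gFactor_pow_le_pow hZne hexp).trans (le_of_eq ?_)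
      rw [gFactor_insertNth, mul_pow, mul_comm]
    calc zslotConst CT C₀ p₀ (m + 1) i (Real.cos θ) *
          gFactor (i.insertNth (α := fun _ => ℂ) τ fun j => (u' j : ℂ)) ^ pieceExp p₀ (m + 1) i
        ≤ zCsec CT C₀ p₀ (m + 1) c' *
          (gFactor (fun j => (u' j : ℂ)) ^ stepExp p₀ (m + 1) * (‖τ‖ + ‖τ‖⁻¹) ^ stepExp p₀ (m + 1)) :=
          mul_le_mul (zslotConst_le_zCsec CT C₀ p₀ i hc') hle (pow_nonneg (gFactor_nonneg _) _)
            (zCsec_nonneg _ _ _ _ _)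
      _ = zCsec CT C₀ p₀ (m + 1) c' * gFactor (fun j => (u' j : ℂ)) ^ stepExp p₀ (m + 1) *
          (‖τ‖ + ‖τ‖⁻¹) ^ stepExp p₀ (m + 1) := by ring
  slot_real i u' hu x hx := slotE_ofReal hΦ hD c i hu hx

end SlotBounds

/-! ### Level data at `0` with growth, from the real-point data -/

section LevelZero

variable {T : ℂ → H →L[ℂ] H} {CT : ℝ}
  {Φ : (n : ℕ) → (Fin (n + 1) → E) → ℝ → (Fin n → ℝ) → H}
  {good : (k : ℕ) → (Fin (k + 1) → E) → Prop} {S₀ : (k : ℕ) → (Fin (k + 1) → E) → (Fin k → ℂ) → ℂ}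
  {C₀ : ℕ → ℝ} {p₀ : ℕ → ℕ}

/-- The `ℓ¹`-level of a set of argument vectors: `sup_{v ∈ K} ∑ |vᵢ|`. [folklore] -/
def l1Sup {k : ℕ} (K : Set (Fin k → ℝ)) : ℝ := sSup ((fun v : Fin k → ℝ => ∑ i, |v i|) '' K)

/-- An intermediate opening between the `ℓ¹`-level of `K` and `π/2`. [folklore] -/
def cLev {k : ℕ} (K : Set (Fin k → ℝ)) : ℝ := (l1Sup K + Real.pi / 2) / 2

/-- Points of a compact set lie below its `ℓ¹`-level. [folklore] -/
theorem sum_abs_le_l1Sup {k : ℕ} {K : Set (Fin k → ℝ)} (hK : IsCompact K) {v : Fin k → ℝ} (hv : v ∈ K) :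
    ∑ i, |v i| ≤ l1Sup K :=
  le_csSup (hK.image (continuous_finsetSum _ fun i _ => (continuous_apply i).abs)).bddAbove
    (mem_image_of_mem _ hv)

/-- The `ℓ¹`-level of a nonempty compact part of the `ℓ¹`-ball is `< π/2`. [folklore] -/
theorem l1Sup_lt {k : ℕ} {K : Set (Fin k → ℝ)} (hK : IsCompact K) (hne : K.Nonempty)
    (hsub : K ⊆ {v | ∑ i, |v i| < Real.pi / 2}) : l1Sup K < Real.pi / 2 := by
  have hc : Continuous fun v : Fin k → ℝ => ∑ i, |v i| := continuous_finsetSum _ fun i _ => (continuous_apply i).abs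
  obtain ⟨v, hv, hmem⟩ := (hK.image hc).sSup_mem (hne.image _)
  rw [l1Sup, ← hmem]
  exact hsub hv

/-- **The exponent of the level-`0` growth.** [folklore] -/
def zeroExp (p₀ : ℕ → ℕ) (k : ℕ) : ℕ := stepExp p₀ k + 1

/-- **The constant of the level-`0` growth on a compact part `K` of `c_k^{(1)}`**: the weighted
maximum principle at the opening `cLev K`. [folklore] -/
def zeroConst (CT : ℝ) (C₀ : ℕ → ℝ) (p₀ : ℕ → ℕ) (k : ℕ) (K : Set (Fin k → ℝ)) : ℝ :=
  max (C₀ k) (zCsec CT C₀ p₀ k (cLev K)) * (2 : ℝ) ^ (k * (stepExp p₀ k + 1))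

/-- The argument region of `c_{m+1}^{(1)}` is the sector region of opening `π/2`. [cite: OsterwalderSchraderCMP1975, Ch. V (5.8), Ch. V.2 (5.25)] -/
theorem argRegion_osBaseC_one (m : ℕ) : argRegion (osBaseC 1 (m + 1)) = sectorRegion m (Real.pi / 2) := by
  rw [osBaseC_one (Nat.succ_pos m), sectorRegion_eq_setOf]
  rfl

/-- **Level data at `0` with growth, from the real-point data** (OS II (A₀), (P₀) ⇒ (A₁) with (6.28)
at `N = 1`): under the semigroup hypotheses, the labelled real-point vectors, a class of labels
closed under the doubling of the parts and labelled real-point data, there is `S` with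
`IsOSLabelledLevel 0 good S Φ`, `IsOSLabelledGrowth 0 good S zeroConst zeroExp`, and `S = S₀` at the
positive real points. [cite: OsterwalderSchraderCMP1975, Ch. V (5.8), Ch. V.2 (5.15)–(5.19), Ch. VI.2 (6.28)] -/
theorem IsOSLabelledRealData.exists_levelZero [CompleteSpace H] (hT : IsOSSemigroup T CT)
    (hΦ : IsOSLabelledVectors T Φ) (hgood : IsOSLabelSet good) (hD : IsOSLabelledRealData good S₀ Φ C₀ p₀) :
    ∃ S : (k : ℕ) → (Fin (k + 1) → E) → (Fin k → ℂ) → ℂ,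
      IsOSLabelledLevel 0 good S Φ ∧
      IsOSLabelledGrowth 0 good S (zeroConst CT C₀ p₀) (zeroExp p₀) ∧
      ∀ (k : ℕ) (c : Fin (k + 1) → E) (ρ : Fin k → ℝ), (∀ i, 0 < ρ i) →
        S k c (fun i => (ρ i : ℂ)) = S₀ k c (fun i => (ρ i : ℂ)) := by
  classical
  have hπ : 0 < Real.pi / 2 := by positivity
  -- the continuations for the good labels with `k = m + 1`
  have hex : ∀ (m : ℕ) (c : Fin (m + 1 + 1) → E), good (m + 1) c →
      ∃ G : (Fin (m + 1) → ℂ) → ℂ, DifferentiableOn ℂ G (sectorRegion m (Real.pi / 2)) ∧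
        ∀ u : Fin (m + 1) → ℝ, (∀ j, 0 < u j) → G (fun j => (u j : ℂ)) = S₀ (m + 1) c fun j => (u j : ℂ) :=
    fun m c hc => (hD.isSectorData hT hΦ hgood hc).exists_extension hπ le_rfl
  choose! G hGd hGr using hex
  -- the level-`0` functions
  set S : (k : ℕ) → (Fin (k + 1) → E) → (Fin k → ℂ) → ℂ := fun k =>
    match k with
    | 0 => fun c Z => S₀ 0 c Z
    | m + 1 => fun c Z => if good (m + 1) c then G m c Z else S₀ (m + 1) c Z with hS
  have hS0 : ∀ c, S 0 c = fun Z => S₀ 0 c Z := fun c => rfl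
  have hSs : ∀ (m : ℕ) (c : Fin (m + 1 + 1) → E),
      S (m + 1) c = fun Z => if good (m + 1) c then G m c Z else S₀ (m + 1) c Z := fun m c => rfl
  have hSgood : ∀ (m : ℕ) (c : Fin (m + 1 + 1) → E), good (m + 1) c → S (m + 1) c = G m c := by
    intro m c hc; rw [hSs]; funext Z; rw [if_pos hc]
  have hreal : ∀ (k : ℕ) (c : Fin (k + 1) → E) (ρ : Fin k → ℝ), (∀ i, 0 < ρ i) →
      S k c (fun i => (ρ i : ℂ)) = S₀ k c (fun i => (ρ i : ℂ)) := by
    intro k c ρ hρ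
    cases k with
    | zero => rfl
    | succ m =>
      rw [hSs]
      by_cases hc : good (m + 1) c
      · simp only [if_pos hc]; exact hGr m c hc ρ hρ
      · simp only [if_neg hc]
  refine ⟨S, ⟨fun k c hc => ?_, fun k c p ρ hρ x' x hx' hx hsum => ?_⟩, ⟨fun k c hc K hK hKc Z hZ => ?_⟩, hreal⟩
  · -- holomorphy on the region of `c^{(1)}`
    cases k with
    | zero => rw [osBaseC_succ_zero, argRegion_empty]; exact differentiableOn_empty
    | succ m => rw [argRegion_osBaseC_one, hSgood m c hc]; exact hGd m c hc
  · -- the Gram identities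
    rw [hreal k c ρ hρ]
    exact hD.gram k c p ρ hρ x' x hx' hx hsum
  · -- the growth
    cases k with
    | zero =>
      rw [osBaseC_succ_zero] at hK
      exact absurd (hK hZ.2) (notMem_empty _)
    | succ m =>
      rw [osBaseC_one (Nat.succ_pos m)] at hK
      have hne : K.Nonempty := ⟨_, hZ.2⟩
      have hθ : l1Sup K < Real.pi / 2 := l1Sup_lt hKc hne hK
      have hθZ : ∑ i, |(Z i).arg| ≤ l1Sup K := sum_abs_le_l1Sup hKc hZ.2
      have hθ0 : 0 ≤ l1Sup K := (Finset.sum_nonneg fun i _ => abs_nonneg _).trans hθZ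
      have hc0 : 0 < cLev K := by rw [cLev]; linarith
      have hclt : cLev K < Real.pi / 2 := by rw [cLev]; linarith
      have hZsec : Z ∈ sectorRegion m (cLev K) := ⟨hZ.1, by rw [cLev]; linarith⟩
      have hb := (hD.isSectorData hT hΦ hgood hc).norm_extension_le_gFactor hπ le_rfl (hGd m c hc) (hGr m c hc)
        hc0 hclt hZsec
      rw [hSgood m c hc]
      simpa only [zeroConst, zeroExp] using hb

/-- **Osterwalder–Schrader II, Theorem 4.2, from real-point data** (the analytic continuation of the
Schwinger functions in all time gaps to the product of right half-planes): under the semigroup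
hypotheses (`IsOSSemigroup`), the labelled real-point vectors (`IsOSLabelledVectors`), a class of
labels closed under the doubling of the parts (`IsOSLabelSet`) and labelled real-point data
(`IsOSLabelledRealData`: the Gram identities (5.2) at positive real points, continuity and the
real-point growth for the good labels), for every `k ≥ 1` and every good label `c` there is `Sext`
holomorphic on `ℂ₊ᵏ = {Re ζᵢ > 0}` with `Sext(ρ) = S₀ k c ρ` at every positive real point and, on the
argument region of every compact part `K` of the cube `(-π/2, π/2)ᵏ`, the explicit label-uniform bound
`‖Sext Z‖ ≤ cubeConst K · Π(Z)^{cubeExp K}` (Ch. V.2 induction `OSLabelledStep` started at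
`exists_levelZero`; `⋃_N C_k^{(N)} = ℂ₊ᵏ`, Lemma 5.2). [cite: OsterwalderSchraderCMP1975, §IV.2 Thm. 4.2; Ch. V (5.2)–(5.8); Ch. V.2 pp. 294–296, Lemma 5.2; Ch. VI.2 (6.28)] -/
theorem IsOSLabelledRealData.exists_continuation [CompleteSpace H] (hT : IsOSSemigroup T CT)
    (hΦ : IsOSLabelledVectors T Φ) (hgood : IsOSLabelSet good) (hD : IsOSLabelledRealData good S₀ Φ C₀ p₀)
    {k : ℕ} (hk : 0 < k) {c : Fin (k + 1) → E} (hc : good k c) :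
    ∃ Sext : (Fin k → ℂ) → ℂ,
      DifferentiableOn ℂ Sext {Z | ∀ i, 0 < (Z i).re} ∧
      (∀ ρ : Fin k → ℝ, (∀ i, 0 < ρ i) → Sext (fun i => (ρ i : ℂ)) = S₀ k c (fun i => (ρ i : ℂ))) ∧
      ∀ K : Set (Fin k → ℝ), IsCompact K → K ⊆ {v | ∀ i, |v i| < Real.pi / 2} →
        ∀ Z ∈ argRegion K, ‖Sext Z‖ ≤
          cubeConst 0 CT (zeroConst CT C₀ p₀) (zeroExp p₀) k K *
            gFactor Z ^ cubeExp 0 CT (zeroConst CT C₀ p₀) (zeroExp p₀) k K := by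
  obtain ⟨S, hL, hG, hreal⟩ := hD.exists_levelZero hT hΦ hgood
  obtain ⟨Sext, hd, heq, hb⟩ := hL.exists_continuation_halfPlanes_uniform hT hΦ hgood hG hk hc
  refine ⟨Sext, hd, fun ρ hρ => ?_, hb⟩
  have hmem : (fun i => (ρ i : ℂ)) ∈ argRegion (osBaseC (0 + 1) k) :=
    ofReal_mem_argRegion (zero_mem_osBaseC _ hk) hρ
  rw [heq hmem, hreal k c ρ hρ]

end LevelZero

end Literature.MathematicalPhysics.QuantumFieldTheory.OSEnvelope
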